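import Literature.MathematicalPhysics.QuantumFieldTheory.ConstructiveQFTWave0CovariantRPProofs
import Literature.MathematicalPhysics.QuantumFieldTheory.ConstructiveQFTWave0SiteRPProofs
import Literature.MathematicalPhysics.QuantumFieldTheory.LatticeGaugeProofs
import HarnessLib

/-!
# Reflection-positivity (Gram) inequalities for rectangular Wilson loops on the even torus

Theorem-only consequences of the two Osterwalder–Seiler reflection positivities of the torus
Wilson measure `μ_{Λ_L,β}`, `L` even (`wilsonExpectation_nonneg_of_covariant`: hyperplanes
between sites, `θ t = 1 - t`; `wilsonExpectation_siteReflectionPositive`: hyperplanes through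
sites, `θ' t = -t`), for the rectangular Wilson loops `W_L(h) = ⟨W_{h × R}⟩_{Λ_L,β}` with `h`
steps in the time direction `0` and `R` steps in a spatial direction `j`
(`wilsonLoop ρ 0 0 j h R`). Writing a loop bisected by a reflection hyperplane as
"staple × reflected staple" (`rectangleHolonomy_eq_link`, `rectangleHolonomy_eq_site`) gives the
Gram inequalities of the transfer-matrix formalism (E. Seiler, LNP 159 (1982) §2; the matrices
`[W(s+t)]` resp. `[W(s+t+1)]` are positive semi-definite):

* `gram_wilsonLoop_nonneg_site`: `0 ≤ ∑_{a,b ∈ S} c_a c_b W_L(a + b)` (heights `≤ L/2`, any `β`);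
* `gram_wilsonLoop_nonneg_link`: `0 ≤ ∑_{a,b ∈ S} c_a c_b W_L(a + b + 1)` (heights `+1 ≤ L/2`,
  `β ≥ 0`).

All statements here are proved; the only definitions are the base point, the two staples and
the covariant word entering the proofs. [folklore]
-/

open MeasureTheory Finset Complex
open scoped ComplexOrder ENNReal ComplexConjugate

namespace Literature.MathematicalPhysics.QuantumFieldTheory

noncomputable section

namespace WilsonLoopRP

open WilsonRP WilsonSiteRP
open Literature.RepresentationTheory.CompactGroups

/-! ## Straight-line holonomies: algebra -/

section Lines

variable {d L : ℕ} {G : Type*} [Group G]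

/-- `lineHolonomy` along `m + n` steps splits after `m` steps. [folklore] -/
theorem lineHolonomy_add (U : GaugeConfig d L G) (k : Fin d) :
    ∀ (m n : ℕ) (y : Site d L), lineHolonomy U k (m + n) y =
      lineHolonomy U k m y * lineHolonomy U k n (y + Pi.single k (m : ZMod L))
  | 0, n, y => by simp [lineHolonomy]
  | m + 1, n, y => by
    rw [show m + 1 + n = (m + n) + 1 by ring, lineHolonomy, lineHolonomy_add U k m n, lineHolonomy,
      mul_assoc]
    congr 2
    simp only [Site.shift, add_assoc, ← Pi.single_add]
    congr 2
    push_cast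
    ring

/-- `lineHolonomy` along `n + 1` steps splits before the last step. [folklore] -/
theorem lineHolonomy_succ_right (U : GaugeConfig d L G) (k : Fin d) (n : ℕ) (y : Site d L) :
    lineHolonomy U k (n + 1) y = lineHolonomy U k n y * U (y + Pi.single k (n : ZMod L), k) := by
  rw [lineHolonomy_add U k n 1 y]
  simp [lineHolonomy]

/-- `(y + e_k) + n e_k = y + (n + 1) e_k`. [folklore] -/
theorem shift_add_single (y : Site d L) (k : Fin d) (n : ℕ) :
    y.shift k + Pi.single k (n : ZMod L) = y + Pi.single k (((n + 1 : ℕ) : ZMod L)) := by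
  simp only [Site.shift, add_assoc, ← Pi.single_add]
  congr 2
  push_cast
  ring

/-- `lineHolonomy U k n y` only reads the links `(y + s e_k, k)`, `s < n`. [folklore] -/
theorem lineHolonomy_congr {U V : GaugeConfig d L G} (k : Fin d) :
    ∀ (n : ℕ) (y : Site d L),
      (∀ s : ℕ, s < n → U (y + Pi.single k (s : ZMod L), k) = V (y + Pi.single k (s : ZMod L), k)) →
      lineHolonomy U k n y = lineHolonomy V k n y
  | 0, y, _ => by simp [lineHolonomy]
  | n + 1, y, h => by
    rw [lineHolonomy, lineHolonomy]
    have h0 := h 0 (Nat.succ_pos n)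
    simp only [Nat.cast_zero, Pi.single_zero, add_zero] at h0
    rw [h0, lineHolonomy_congr k n (y.shift k) fun s hs => ?_]
    rw [shift_add_single]
    exact h (s + 1) (by omega)

variable [MeasurableSpace G]

/-- Straight lines of a translated configuration. [folklore] -/
theorem lineHolonomy_torusConfigShift (v : Site d L) (U : GaugeConfig d L G) (k : Fin d) :
    ∀ (n : ℕ) (y : Site d L),
      lineHolonomy (torusConfigShift v U) k n y = lineHolonomy U k n (y - v)
  | 0, y => by simp [lineHolonomy]
  | n + 1, y => by
    rw [lineHolonomy, lineHolonomy, lineHolonomy_torusConfigShift v U k n, torusConfigShift_apply]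
    congr 2
    simp only [Site.shift]
    abel

/-- Rectangles of a translated configuration. [folklore] -/
theorem rectangleHolonomy_torusConfigShift (v : Site d L) (U : GaugeConfig d L G) (x : Site d L)
    (i j : Fin d) (R T : ℕ) :
    rectangleHolonomy (torusConfigShift v U) x i j R T = rectangleHolonomy U (x - v) i j R T := by
  simp only [rectangleHolonomy, lineHolonomy_torusConfigShift, add_sub_right_comm]

end Lines

/-! ## Straight-line holonomies under the two time reflections -/

section Reflect

variable {d L : ℕ} [NeZero d] {G : Type*} [Group G]

/-- Spatial lines of the link-reflected configuration: `Θ U` along `j ≠ 0` from `y` is `U` along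
`j` from `θ y`. [folklore] -/
theorem lineHolonomy_timeReflect_of_ne (U : GaugeConfig d L G) {j : Fin d} (hj : j ≠ 0) :
    ∀ (n : ℕ) (y : Site d L),
      lineHolonomy U.timeReflect j n y = lineHolonomy U j n y.timeReflect
  | 0, y => by simp [lineHolonomy]
  | n + 1, y => by
    rw [lineHolonomy, lineHolonomy, lineHolonomy_timeReflect_of_ne U hj n, timeReflect_apply]
    simp only [edgeReflect, hj, ↓reduceIte, timeReflect_shift_of_ne _ hj]

/-- `θ(y + (n+1) e₀) + n e₀ = θ(y + e₀)`. [folklore] -/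
theorem timeReflect_add_single_succ (y : Site d L) (n : ℕ) :
    (y + Pi.single 0 (((n + 1 : ℕ) : ZMod L))).timeReflect + Pi.single 0 (n : ZMod L) =
      (y.shift 0).timeReflect := by
  funext k
  by_cases hk : k = 0
  · subst hk
    simp only [Pi.add_apply, timeReflect_apply_zero, Pi.single_eq_same, shift_apply_self]
    push_cast
    ring
  · simp [timeReflect_apply_of_ne _ hk, shift_apply_of_ne _ hk, hk]

/-- Temporal lines of the link-reflected configuration: `Θ U` upwards `n` steps from `y` is the
inverse of `U` upwards `n` steps from `θ(y + n e₀)`. [folklore] -/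
theorem lineHolonomy_timeReflect_zero (U : GaugeConfig d L G) :
    ∀ (n : ℕ) (y : Site d L), lineHolonomy U.timeReflect 0 n y =
      (lineHolonomy U 0 n (y + Pi.single 0 (n : ZMod L)).timeReflect)⁻¹
  | 0, y => by simp [lineHolonomy]
  | n + 1, y => by
    rw [lineHolonomy, lineHolonomy_timeReflect_zero U n, timeReflect_apply, shift_add_single,
      lineHolonomy_succ_right, timeReflect_add_single_succ, mul_inv_rev]
    simp [edgeReflect]

/-- Spatial lines of the site-reflected configuration. [folklore] -/
theorem lineHolonomy_negReflect_of_ne (U : GaugeConfig d L G) {j : Fin d} (hj : j ≠ 0) :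
    ∀ (n : ℕ) (y : Site d L),
      lineHolonomy U.negReflect j n y = lineHolonomy U j n y.negReflect
  | 0, y => by simp [lineHolonomy]
  | n + 1, y => by
    rw [lineHolonomy, lineHolonomy, lineHolonomy_negReflect_of_ne U hj n, negReflect_apply]
    simp only [siteEdgeReflect, hj, ↓reduceIte, negReflect_shift_of_ne _ hj]

/-- `θ'(y + (n+1) e₀) + n e₀ = θ'(y + e₀)`. [folklore] -/
theorem negReflect_add_single_succ (y : Site d L) (n : ℕ) :
    (y + Pi.single 0 (((n + 1 : ℕ) : ZMod L))).negReflect + Pi.single 0 (n : ZMod L) =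
      (y.shift 0).negReflect := by
  funext k
  by_cases hk : k = 0
  · subst hk
    simp only [Pi.add_apply, negReflect_apply_zero, Pi.single_eq_same, shift_apply_self]
    push_cast
    ring
  · simp [negReflect_apply_of_ne _ hk, shift_apply_of_ne _ hk, hk]

/-- Temporal lines of the site-reflected configuration. [folklore] -/
theorem lineHolonomy_negReflect_zero (U : GaugeConfig d L G) :
    ∀ (n : ℕ) (y : Site d L), lineHolonomy U.negReflect 0 n y =
      (lineHolonomy U 0 n (y + Pi.single 0 (n : ZMod L)).negReflect)⁻¹
  | 0, y => by simp [lineHolonomy]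
  | n + 1, y => by
    rw [lineHolonomy, lineHolonomy_negReflect_zero U n, negReflect_apply, shift_add_single,
      lineHolonomy_succ_right, negReflect_add_single_succ, mul_inv_rev]
    simp [siteEdgeReflect]

end Reflect

/-! ## Staples and the decomposition of bisected rectangles -/

section Staples

variable {d L : ℕ} [NeZero d] {G : Type*} [Group G]

/-- The base point `(-b, 0⃗)` of the loops of this file. [folklore] -/
def tBase (b : ℕ) : Site d L := -Pi.single 0 (b : ZMod L)

/-- The link staple of height `a` and width `R` (direction `j`) hanging from the time slice
`t = 1`: the holonomy along `(1,0⃗) → (1+a,0⃗) → (1+a, R eⱼ) → (1, R eⱼ)`. [folklore] -/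
def linkStaple (j : Fin d) (R a : ℕ) (V : GaugeConfig d L G) : G :=
  lineHolonomy V 0 a ((0 : Site d L).shift 0) *
    lineHolonomy V j R ((0 : Site d L).shift 0 + Pi.single 0 (a : ZMod L)) *
      (lineHolonomy V 0 a ((0 : Site d L).shift 0 + Pi.single j (R : ZMod L)))⁻¹

/-- The covariant word `V(c₀) · linkStaple · V(c_R)⁻¹` of a link staple together with the two
crossing links `c₀ = ((0,0⃗), 0)`, `c_R = ((0, R eⱼ), 0)` under its feet. [folklore] -/
def linkWord (j : Fin d) (R a : ℕ) (V : GaugeConfig d L G) : G :=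
  V (0, 0) * linkStaple j R a V * (V ((0 : Site d L) + Pi.single j (R : ZMod L), 0))⁻¹

/-- The site staple of height `a` and width `R` standing on the time slice `t = 0`: the holonomy
along `(0,0⃗) → (a,0⃗) → (a, R eⱼ) → (0, R eⱼ)`. [folklore] -/
def siteStaple (j : Fin d) (R a : ℕ) (V : GaugeConfig d L G) : G :=
  lineHolonomy V 0 a 0 * lineHolonomy V j R ((0 : Site d L) + Pi.single 0 (a : ZMod L)) *
    (lineHolonomy V 0 a ((0 : Site d L) + Pi.single j (R : ZMod L)))⁻¹

/-- `(-b) + b = 0`. [folklore] -/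
theorem tBase_add_single (b : ℕ) : (tBase b : Site d L) + Pi.single 0 (b : ZMod L) = 0 := by
  simp [tBase]

/-- Evaluating a unit vector of the time axis off the time axis. [folklore] -/
private theorem single_zero_apply_of_ne {k : Fin d} (hk : k ≠ 0) (c : ZMod L) :
    (Pi.single (0 : Fin d) c : Site d L) k = 0 := Pi.single_eq_of_ne hk _

/-- `(-b) + (a + b + 1) e₀ = e₀ + a e₀`. [folklore] -/
theorem tBase_add_single_link (a b : ℕ) :
    (tBase b : Site d L) + Pi.single 0 (((a + b + 1 : ℕ) : ZMod L)) =
      (0 : Site d L).shift 0 + Pi.single 0 (a : ZMod L) := by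
  funext k
  by_cases hk : k = 0
  · subst hk
    simp only [tBase, Site.shift, Pi.add_apply, Pi.neg_apply, Pi.single_eq_same, Pi.zero_apply,
      Nat.cast_add, Nat.cast_one]
    ring
  · simp only [tBase, Site.shift, Pi.add_apply, Pi.neg_apply, Pi.zero_apply,
      single_zero_apply_of_ne hk, neg_zero, add_zero]

/-- `(-b) + (a + b) e₀ = a e₀`. [folklore] -/
theorem tBase_add_single_site (a b : ℕ) :
    (tBase b : Site d L) + Pi.single 0 (((a + b : ℕ) : ZMod L)) =
      (0 : Site d L) + Pi.single 0 (a : ZMod L) := by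
  funext k
  by_cases hk : k = 0
  · subst hk
    simp only [tBase, Pi.add_apply, Pi.neg_apply, Pi.single_eq_same, Pi.zero_apply, Nat.cast_add]
    ring
  · simp only [tBase, Pi.add_apply, Pi.neg_apply, Pi.zero_apply, single_zero_apply_of_ne hk,
      neg_zero, add_zero]

/-- `(-b, R eⱼ) + b e₀ = (0, R eⱼ)`. [folklore] -/
theorem tBase_add_single_right (j : Fin d) (R b : ℕ) :
    (tBase b : Site d L) + Pi.single j (R : ZMod L) + Pi.single 0 (b : ZMod L) =
      (0 : Site d L) + Pi.single j (R : ZMod L) := by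
  rw [add_right_comm, tBase_add_single]

/-- `(0, R eⱼ) + e₀ = e₀ + R eⱼ`. [folklore] -/
theorem shift_single_right (j : Fin d) (R : ℕ) :
    ((0 : Site d L) + Pi.single j (R : ZMod L)).shift 0 =
      (0 : Site d L).shift 0 + Pi.single j (R : ZMod L) := by
  simp only [Site.shift, add_right_comm]

/-- `θ(e₀ + b e₀) = (-b, 0⃗)`. [folklore] -/
theorem timeReflect_shift_add_single (b : ℕ) :
    ((0 : Site d L).shift 0 + Pi.single 0 (b : ZMod L)).timeReflect = tBase b := by
  funext k
  by_cases hk : k = 0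
  · subst hk
    simp only [timeReflect_apply_zero, Site.shift, Pi.add_apply, Pi.single_eq_same, Pi.zero_apply,
      tBase, Pi.neg_apply]
    ring
  · simp only [timeReflect_apply_of_ne _ hk, tBase, Site.shift, Pi.add_apply, Pi.zero_apply,
      Pi.neg_apply, single_zero_apply_of_ne hk, neg_zero, add_zero]

/-- `θ(e₀ + R eⱼ + b e₀) = (-b, R eⱼ)`. [folklore] -/
theorem timeReflect_shift_add_single_right {j : Fin d} (hj : j ≠ 0) (R b : ℕ) :
    ((0 : Site d L).shift 0 + Pi.single j (R : ZMod L) + Pi.single 0 (b : ZMod L)).timeReflect =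
      tBase b + Pi.single j (R : ZMod L) := by
  funext k
  by_cases hk : k = 0
  · subst hk
    simp only [timeReflect_apply_zero, Site.shift, Pi.add_apply, Pi.single_eq_same, Pi.zero_apply,
      tBase, Pi.neg_apply, Pi.single_eq_of_ne (Ne.symm hj), add_zero]
    ring
  · simp only [timeReflect_apply_of_ne _ hk, tBase, Site.shift, Pi.add_apply,
      Pi.neg_apply, single_zero_apply_of_ne hk, neg_zero, zero_add, add_zero]

/-- `θ'(b e₀) = (-b, 0⃗)`. [folklore] -/
theorem negReflect_add_single (b : ℕ) :
    ((0 : Site d L) + Pi.single 0 (b : ZMod L)).negReflect = tBase b := by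
  funext k
  by_cases hk : k = 0
  · subst hk
    simp only [negReflect_apply_zero, Pi.single_eq_same, tBase, Pi.neg_apply, zero_add]
  · simp only [negReflect_apply_of_ne _ hk, tBase, Pi.add_apply, Pi.zero_apply, Pi.neg_apply,
      single_zero_apply_of_ne hk, neg_zero, add_zero]

/-- `θ'(R eⱼ + b e₀) = (-b, R eⱼ)`. [folklore] -/
theorem negReflect_add_single_right {j : Fin d} (hj : j ≠ 0) (R b : ℕ) :
    ((0 : Site d L) + Pi.single j (R : ZMod L) + Pi.single 0 (b : ZMod L)).negReflect =
      tBase b + Pi.single j (R : ZMod L) := by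
  funext k
  by_cases hk : k = 0
  · subst hk
    simp only [negReflect_apply_zero, Pi.add_apply, Pi.single_eq_same, tBase,
      Pi.neg_apply, Pi.single_eq_of_ne (Ne.symm hj), add_zero, zero_add]
  · simp only [negReflect_apply_of_ne _ hk, tBase, Pi.add_apply, Pi.neg_apply,
      single_zero_apply_of_ne hk, neg_zero, zero_add, add_zero]

/-- The link staple of the link-reflected configuration is the lower staple
`(0,0⃗) → (-b,0⃗) → (-b, R eⱼ) → (0, R eⱼ)`. [folklore] -/
theorem linkStaple_timeReflect (U : GaugeConfig d L G) {j : Fin d} (hj : j ≠ 0) (R b : ℕ) :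
    linkStaple j R b U.timeReflect =
      (lineHolonomy U 0 b (tBase b))⁻¹ * lineHolonomy U j R (tBase b) *
        lineHolonomy U 0 b (tBase b + Pi.single j (R : ZMod L)) := by
  unfold linkStaple
  rw [lineHolonomy_timeReflect_zero, lineHolonomy_timeReflect_of_ne U hj,
    lineHolonomy_timeReflect_zero, timeReflect_shift_add_single,
    timeReflect_shift_add_single_right hj, inv_inv]

/-- The site staple of the site-reflected configuration is the lower staple. [folklore] -/
theorem siteStaple_negReflect (U : GaugeConfig d L G) {j : Fin d} (hj : j ≠ 0) (R b : ℕ) :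
    siteStaple j R b U.negReflect =
      (lineHolonomy U 0 b (tBase b))⁻¹ * lineHolonomy U j R (tBase b) *
        lineHolonomy U 0 b (tBase b + Pi.single j (R : ZMod L)) := by
  unfold siteStaple
  rw [lineHolonomy_negReflect_zero, lineHolonomy_negReflect_of_ne U hj,
    lineHolonomy_negReflect_zero, negReflect_add_single, negReflect_add_single_right hj, inv_inv]

/-- **Decomposition of a rectangle bisected by the hyperplane between `t = 0` and `t = 1`.**
The `(a+b+1) × R` rectangle based at `(-b, 0⃗)` is, up to conjugation by the left lower column,
`(c₀ · staple_a · c_R⁻¹) · (staple_b ∘ Θ)⁻¹`. [folklore] -/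
theorem rectangleHolonomy_eq_link (U : GaugeConfig d L G) {j : Fin d} (hj : j ≠ 0) (R a b : ℕ) :
    rectangleHolonomy U (tBase b) 0 j (a + b + 1) R =
      lineHolonomy U 0 b (tBase b) * (linkWord j R a U * (linkStaple j R b U.timeReflect)⁻¹) *
        (lineHolonomy U 0 b (tBase b))⁻¹ := by
  have h1 : lineHolonomy U 0 (a + b + 1) (tBase b) =
      lineHolonomy U 0 b (tBase b) * (U (0, 0) * lineHolonomy U 0 a ((0 : Site d L).shift 0)) := by
    rw [show a + b + 1 = b + (a + 1) by ring, lineHolonomy_add, tBase_add_single]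
    rfl
  have h3 : lineHolonomy U 0 (a + b + 1) (tBase b + Pi.single j (R : ZMod L)) =
      lineHolonomy U 0 b (tBase b + Pi.single j (R : ZMod L)) *
        (U ((0 : Site d L) + Pi.single j (R : ZMod L), 0) *
          lineHolonomy U 0 a ((0 : Site d L).shift 0 + Pi.single j (R : ZMod L))) := by
    rw [show a + b + 1 = b + (a + 1) by ring, lineHolonomy_add, tBase_add_single_right,
      ← shift_single_right]
    rfl
  unfold rectangleHolonomy linkWord
  rw [h1, tBase_add_single_link, h3, linkStaple_timeReflect U hj]
  unfold linkStaple
  simp only [mul_inv_rev, inv_inv, mul_assoc, mul_inv_cancel, mul_one]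

/-- **Decomposition of a rectangle bisected by the hyperplane `t = 0`.** The `(a+b) × R`
rectangle based at `(-b, 0⃗)` is, up to conjugation, `staple'_a · (staple'_b ∘ Θ')⁻¹`. [folklore] -/
theorem rectangleHolonomy_eq_site (U : GaugeConfig d L G) {j : Fin d} (hj : j ≠ 0) (R a b : ℕ) :
    rectangleHolonomy U (tBase b) 0 j (a + b) R =
      lineHolonomy U 0 b (tBase b) * (siteStaple j R a U * (siteStaple j R b U.negReflect)⁻¹) *
        (lineHolonomy U 0 b (tBase b))⁻¹ := by
  have h1 : lineHolonomy U 0 (a + b) (tBase b) =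
      lineHolonomy U 0 b (tBase b) * lineHolonomy U 0 a 0 := by
    rw [show a + b = b + a by ring, lineHolonomy_add, tBase_add_single]
  have h3 : lineHolonomy U 0 (a + b) (tBase b + Pi.single j (R : ZMod L)) =
      lineHolonomy U 0 b (tBase b + Pi.single j (R : ZMod L)) *
        lineHolonomy U 0 a ((0 : Site d L) + Pi.single j (R : ZMod L)) := by
    rw [show a + b = b + a by ring, lineHolonomy_add, tBase_add_single_right]
  unfold rectangleHolonomy
  rw [h1, tBase_add_single_site, h3, siteStaple_negReflect U hj]
  unfold siteStaple
  simp only [mul_inv_rev, inv_inv, mul_assoc, mul_inv_cancel, mul_one]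

end Staples

/-! ## The links read by the staples -/

section StapleEdges

variable {d L : ℕ} [NeZero d] {G : Type*} [Group G]

/-- The links read by `linkStaple j R a` (as a predicate). [folklore] -/
def IsLinkStapleEdge (j : Fin d) (R a : ℕ) (e : Edge d L) : Prop :=
  (∃ s : ℕ, s < a ∧ e = ((0 : Site d L).shift 0 + Pi.single 0 (s : ZMod L), 0)) ∨
    (∃ s : ℕ, s < R ∧
      e = ((0 : Site d L).shift 0 + Pi.single 0 (a : ZMod L) + Pi.single j (s : ZMod L), j)) ∨
    (∃ s : ℕ, s < a ∧
      e = ((0 : Site d L).shift 0 + Pi.single j (R : ZMod L) + Pi.single 0 (s : ZMod L), 0))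

/-- The links read by `siteStaple j R a` (as a predicate). [folklore] -/
def IsSiteStapleEdge (j : Fin d) (R a : ℕ) (e : Edge d L) : Prop :=
  (∃ s : ℕ, s < a ∧ e = ((0 : Site d L) + Pi.single 0 (s : ZMod L), 0)) ∨
    (∃ s : ℕ, s < R ∧
      e = ((0 : Site d L) + Pi.single 0 (a : ZMod L) + Pi.single j (s : ZMod L), j)) ∨
    (∃ s : ℕ, s < a ∧
      e = ((0 : Site d L) + Pi.single j (R : ZMod L) + Pi.single 0 (s : ZMod L), 0))

/-- The link staple only reads its links. [folklore] -/
theorem linkStaple_congr {U V : GaugeConfig d L G} (j : Fin d) (R a : ℕ)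
    (h : ∀ e, IsLinkStapleEdge j R a e → U e = V e) : linkStaple j R a U = linkStaple j R a V := by
  unfold linkStaple
  rw [lineHolonomy_congr (U := U) (V := V) 0 a _ fun s hs => h _ (Or.inl ⟨s, hs, rfl⟩),
    lineHolonomy_congr (U := U) (V := V) j R _ fun s hs => h _ (Or.inr (Or.inl ⟨s, hs, rfl⟩)),
    lineHolonomy_congr (U := U) (V := V) 0 a _ fun s hs => h _ (Or.inr (Or.inr ⟨s, hs, rfl⟩))]

/-- The site staple only reads its links. [folklore] -/
theorem siteStaple_congr {U V : GaugeConfig d L G} (j : Fin d) (R a : ℕ)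
    (h : ∀ e, IsSiteStapleEdge j R a e → U e = V e) : siteStaple j R a U = siteStaple j R a V := by
  unfold siteStaple
  rw [lineHolonomy_congr (U := U) (V := V) 0 a _ fun s hs => h _ (Or.inl ⟨s, hs, rfl⟩),
    lineHolonomy_congr (U := U) (V := V) j R _ fun s hs => h _ (Or.inr (Or.inl ⟨s, hs, rfl⟩)),
    lineHolonomy_congr (U := U) (V := V) 0 a _ fun s hs => h _ (Or.inr (Or.inr ⟨s, hs, rfl⟩))]

variable [NeZero L] [Fact (1 < L)]

omit [NeZero L] [Fact (1 < L)] in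
/-- The time coordinate of the sites used below. [folklore] -/
private theorem val_apply_zero_eq {x : Site d L} {t : ℕ} (ht : t < L) (hx : x 0 = (t : ZMod L)) :
    (x 0).val = t := by
  rw [hx, ZMod.val_cast_of_lt ht]

/-- The links of a link staple of height `a + 1 ≤ L/2` are positive-time links. [folklore] -/
theorem isPosEdge_of_isLinkStapleEdge {j : Fin d} (hj : j ≠ 0) {R a : ℕ} (ha : a + 1 ≤ L / 2)
    {e : Edge d L} (he : IsLinkStapleEdge j R a e) : IsPosEdge e := by
  have h1L : 1 < L := Fact.out
  have hL2 : L / 2 < L := Nat.div_lt_self (by omega) one_lt_two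
  rw [isPosEdge_iff]
  rcases he with ⟨s, hs, rfl⟩ | ⟨s, hs, rfl⟩ | ⟨s, hs, rfl⟩
  · have ht : (((0 : Site d L).shift 0 + Pi.single 0 (s : ZMod L) : Site d L) 0).val = s + 1 :=
      val_apply_zero_eq (by omega) (by
        simp only [Site.shift, Pi.add_apply, Pi.zero_apply, Pi.single_eq_same, Nat.cast_add,
          Nat.cast_one]; ring)
    simp only [↓reduceIte, ht]
    omega
  · have ht : (((0 : Site d L).shift 0 + Pi.single 0 (a : ZMod L) + Pi.single j (s : ZMod L) :
        Site d L) 0).val = a + 1 :=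
      val_apply_zero_eq (by omega) (by
        simp only [Site.shift, Pi.add_apply, Pi.zero_apply, Pi.single_eq_same,
          Pi.single_eq_of_ne (Ne.symm hj), Nat.cast_add, Nat.cast_one]; ring)
    simp only [hj, ↓reduceIte, ht]
    omega
  · have ht : (((0 : Site d L).shift 0 + Pi.single j (R : ZMod L) + Pi.single 0 (s : ZMod L) :
        Site d L) 0).val = s + 1 :=
      val_apply_zero_eq (by omega) (by
        simp only [Site.shift, Pi.add_apply, Pi.zero_apply, Pi.single_eq_same,
          Pi.single_eq_of_ne (Ne.symm hj), Nat.cast_add, Nat.cast_one]; ring)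
    simp only [↓reduceIte, ht]
    omega

omit [NeZero L] in
/-- The links of a site staple of height `a ≤ L/2` are positive or shared for the site
reflection. [folklore] -/
theorem isSitePosEdge_or_isSharedEdge_of_isSiteStapleEdge {j : Fin d} (hj : j ≠ 0) {R a : ℕ}
    (ha : a ≤ L / 2) {e : Edge d L} (he : IsSiteStapleEdge j R a e) :
    IsSitePosEdge e ∨ IsSharedEdge e := by
  have h1L : 1 < L := Fact.out
  have hL2 : L / 2 < L := Nat.div_lt_self (by omega) one_lt_two
  unfold IsSitePosEdge IsSharedEdge
  rcases he with ⟨s, hs, rfl⟩ | ⟨s, hs, rfl⟩ | ⟨s, hs, rfl⟩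
  · have ht : (((0 : Site d L) + Pi.single 0 (s : ZMod L) : Site d L) 0).val = s :=
      val_apply_zero_eq (by omega) (by
        simp only [Pi.add_apply, Pi.zero_apply, Pi.single_eq_same, zero_add])
    simp only [↓reduceIte, ht]
    omega
  · have ht : (((0 : Site d L) + Pi.single 0 (a : ZMod L) + Pi.single j (s : ZMod L) :
        Site d L) 0).val = a :=
      val_apply_zero_eq (by omega) (by
        simp only [Pi.add_apply, Pi.single_eq_same,
          Pi.single_eq_of_ne (Ne.symm hj), zero_add, add_zero])
    simp only [hj, ↓reduceIte, ht, ne_eq, not_false_eq_true, true_and]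
    omega
  · have ht : (((0 : Site d L) + Pi.single j (R : ZMod L) + Pi.single 0 (s : ZMod L) :
        Site d L) 0).val = s :=
      val_apply_zero_eq (by omega) (by
        simp only [Pi.add_apply, Pi.single_eq_same,
          Pi.single_eq_of_ne (Ne.symm hj), zero_add])
    simp only [↓reduceIte, ht]
    omega

omit [NeZero L] [Fact (1 < L)] in
/-- The two crossing links under the feet of a link staple. [folklore] -/
theorem isLowerCross_foot (j : Fin d) (hj : j ≠ 0) (R : ℕ) :
    IsLowerCross (((0 : Site d L), (0 : Fin d)) : Edge d L) ∧
      IsLowerCross (((0 : Site d L) + Pi.single j (R : ZMod L), (0 : Fin d)) : Edge d L) := by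
  refine ⟨⟨rfl, by simp⟩, ⟨rfl, ?_⟩⟩
  simp [hj.symm]

end StapleEdges

/-! ## The covariance identity for link-bisected rectangles -/

section Covariance

variable {d L N : ℕ} [NeZero d] [NeZero L] [Fact (1 < L)]
variable {G : Type*} [Group G] [TopologicalSpace G] [IsTopologicalGroup G] [CompactSpace G]
  [MeasurableSpace G] [BorelSpace G]
variable (ρ : G →* Matrix (Fin N) (Fin N) ℂ)

omit [NeZero L] [Fact (1 < L)] [MeasurableSpace G] [BorelSpace G] in
/-- The trace of `σ(g) σ(h)⁻¹ = σ(g) σ(h)ᴴ` for the unitarised representation is the Gram pairing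
of the matrix entries. [folklore] -/
theorem trace_unitarize_mul_inv (hρ : Continuous ρ) (g h : G) :
    (CompactGroup.unitarize ρ hρ (g * h⁻¹)).trace =
      ∑ i, ∑ l, CompactGroup.unitarize ρ hρ g i l *
        conj (CompactGroup.unitarize ρ hρ h i l) := by
  rw [map_mul, CompactGroup.unitarize_inv, Matrix.star_eq_conjTranspose, Matrix.trace]
  simp only [Matrix.diag_apply, Matrix.mul_apply, Matrix.conjTranspose_apply, Complex.star_def]

omit [TopologicalSpace G] [IsTopologicalGroup G] [CompactSpace G] [MeasurableSpace G]
  [BorelSpace G] in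
/-- The link staple does not see the substitution `translate`. [folklore] -/
theorem linkStaple_translate (hL : Even L) {j : Fin d} (hj : j ≠ 0) {R a : ℕ} (ha : a + 1 ≤ L / 2)
    (Y U : GaugeConfig d L G) : linkStaple j R a (translate Y U) = linkStaple j R a U :=
  linkStaple_congr j R a fun _ he => translate_apply_of_not_isCrossEdge Y U fun hc =>
    not_isPosEdge_of_isCrossEdge hL hc (isPosEdge_of_isLinkStapleEdge hj ha he)

omit [TopologicalSpace G] [IsTopologicalGroup G] [CompactSpace G] [MeasurableSpace G]
  [BorelSpace G] in
/-- The link staple does not see the splice of the crossing links. [folklore] -/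
theorem linkStaple_splice (hL : Even L) {j : Fin d} (hj : j ≠ 0) {R a : ℕ} (ha : a + 1 ≤ L / 2)
    (U Y : GaugeConfig d L G) :
    linkStaple j R a (LatticeRP.splice crossEdges (U, Y)) = linkStaple j R a U :=
  linkStaple_congr j R a fun _ he => splice_apply_of_not_isCrossEdge U Y fun hc =>
    not_isPosEdge_of_isCrossEdge hL hc (isPosEdge_of_isLinkStapleEdge hj ha he)

omit [TopologicalSpace G] [IsTopologicalGroup G] [CompactSpace G] [MeasurableSpace G]
  [BorelSpace G] in
/-- The reflected link staple does not see the substitution `translate`. [folklore] -/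
theorem linkStaple_timeReflect_translate (hL : Even L) {j : Fin d} (hj : j ≠ 0) {R b : ℕ}
    (hb : b + 1 ≤ L / 2) (Y U : GaugeConfig d L G) :
    linkStaple j R b (translate Y U).timeReflect = linkStaple j R b U.timeReflect :=
  linkStaple_congr j R b fun e he => by
    rw [timeReflect_apply, timeReflect_apply, translate_apply_of_not_isCrossEdge Y U
      (not_isCrossEdge_edgeReflect hL (isPosEdge_of_isLinkStapleEdge hj hb he))]

omit [NeZero L] [Fact (1 < L)] [TopologicalSpace G] [IsTopologicalGroup G] [CompactSpace G]
  [MeasurableSpace G] [BorelSpace G] in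
/-- The crossing links are inverted by the link reflection. [folklore] -/
theorem timeReflect_apply_foot (U : GaugeConfig d L G) {j : Fin d} (hj : j ≠ 0) (R : ℕ) :
    U.timeReflect (0, 0) = (U (0, 0))⁻¹ ∧
      U.timeReflect ((0 : Site d L) + Pi.single j (R : ZMod L), 0) =
        (U ((0 : Site d L) + Pi.single j (R : ZMod L), 0))⁻¹ := by
  have h2 : (0 : Site d L) 0 + (0 : Site d L) 0 = 0 := by simp
  have h2' : ((0 : Site d L) + Pi.single j (R : ZMod L) : Site d L) 0 +
      ((0 : Site d L) + Pi.single j (R : ZMod L) : Site d L) 0 = 0 := by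
    simp [hj.symm]
  constructor
  · rw [timeReflect_apply]
    simp only [edgeReflect, ↓reduceIte, timeReflect_shift_of_two_mul h2]
  · rw [timeReflect_apply]
    simp only [edgeReflect, ↓reduceIte, timeReflect_shift_of_two_mul h2']

omit [MeasurableSpace G] [BorelSpace G] in
/-- **The covariance identity.** After the substitution `translate Y`, the trace of the
`(a+b+1) × R` rectangle bisected by the lower hyperplane is the Gram pairing of the covariant
words of `z = splice_C(U, Y)` and of `Θ U`. [folklore] -/
theorem trace_rectangleHolonomy_translate (hL : Even L) (hρ : Continuous ρ) {j : Fin d} (hj : j ≠ 0)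
    {R a b : ℕ} (ha : a + 1 ≤ L / 2) (hb : b + 1 ≤ L / 2) (U Y : GaugeConfig d L G) :
    (CompactGroup.unitarize ρ hρ
        (rectangleHolonomy (translate Y U) (tBase b) 0 j (a + b + 1) R)).trace =
      ∑ i, ∑ l, CompactGroup.unitarize ρ hρ (linkWord j R a (LatticeRP.splice crossEdges (U, Y))) i l *
        conj (CompactGroup.unitarize ρ hρ (linkWord j R b U.timeReflect) i l) := by
  obtain ⟨hc0, hcR⟩ := isLowerCross_foot (L := L) j hj R
  obtain ⟨hΘ0, hΘR⟩ := timeReflect_apply_foot U hj R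
  rw [rectangleHolonomy_eq_link _ hj, CompactGroup.trace_conj_eq, ← trace_unitarize_mul_inv ρ hρ]
  unfold linkWord
  rw [translate_apply_of_isLowerCross Y U hc0, translate_apply_of_isLowerCross Y U hcR,
    linkStaple_translate hL hj ha, linkStaple_timeReflect_translate hL hj hb,
    splice_apply_of_isCrossEdge U Y hc0.isCrossEdge, splice_apply_of_isCrossEdge U Y hcR.isCrossEdge,
    linkStaple_splice hL hj ha, hΘ0, hΘR]
  rw [show U (0, 0) * Y (0, 0) * linkStaple j R a U *
        (U ((0 : Site d L) + Pi.single j (R : ZMod L), 0) *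
          Y ((0 : Site d L) + Pi.single j (R : ZMod L), 0))⁻¹ *
        (linkStaple j R b U.timeReflect)⁻¹ =
      U (0, 0) * (Y (0, 0) * linkStaple j R a U * (Y ((0 : Site d L) + Pi.single j (R : ZMod L), 0))⁻¹ *
        ((U (0, 0))⁻¹ * linkStaple j R b U.timeReflect *
          ((U ((0 : Site d L) + Pi.single j (R : ZMod L), 0))⁻¹)⁻¹)⁻¹) * (U (0, 0))⁻¹ by group,
    CompactGroup.trace_conj_eq]

end Covariance

/-! ## Entry measurability of the loop observables -/

section Measurability

variable {d L N : ℕ} [NeZero d]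
variable {G : Type*} [Group G] [TopologicalSpace G] [IsTopologicalGroup G] [CompactSpace G]
  [MeasurableSpace G] [BorelSpace G]
variable (ρ : G →* Matrix (Fin N) (Fin N) ℂ)

omit [NeZero d] [TopologicalSpace G] [IsTopologicalGroup G] [CompactSpace G] [BorelSpace G] in
/-- The constant word `1` is entry-measurable. [folklore] -/
theorem entryMeasurable_one {τ : G →* Matrix (Fin N) (Fin N) ℂ} :
    EntryMeasurable τ fun _ : GaugeConfig d L G => (1 : G) := fun k l => by
  simp only [map_one]
  exact measurable_const

omit [NeZero d] [BorelSpace G] in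
/-- Inverses of entry-measurable words are entry-measurable for the unitarised representation
(`σ(g⁻¹) = σ(g)ᴴ`). [folklore] -/
theorem _root_.Literature.MathematicalPhysics.QuantumFieldTheory.WilsonRP.EntryMeasurable.inv_unitarize
    (hρ : Continuous ρ) {f : GaugeConfig d L G → G}
    (hf : EntryMeasurable (CompactGroup.unitarize ρ hρ) f) :
    EntryMeasurable (CompactGroup.unitarize ρ hρ) fun U => (f U)⁻¹ := fun k l => by
  simp only [CompactGroup.unitarize_inv, Matrix.star_apply]
  exact continuous_star.measurable.comp (hf l k)

omit [NeZero d] [IsTopologicalGroup G] [CompactSpace G] in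
/-- Straight lines are entry-measurable. [folklore] -/
theorem entryMeasurable_lineHolonomy {τ : G →* Matrix (Fin N) (Fin N) ℂ} (hτ : Continuous τ)
    (k : Fin d) : ∀ (n : ℕ) (y : Site d L),
      EntryMeasurable τ fun U : GaugeConfig d L G => lineHolonomy U k n y
  | 0, y => by simpa [lineHolonomy] using (entryMeasurable_one (d := d) (L := L) (τ := τ))
  | n + 1, y => by
    simpa [lineHolonomy] using (entryMeasurable_apply hτ _).mul (entryMeasurable_lineHolonomy hτ k n _)

omit [NeZero d] in
/-- Rectangles are entry-measurable for the unitarised representation. [folklore] -/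
theorem entryMeasurable_rectangleHolonomy (hρ : Continuous ρ) (x : Site d L) (i j : Fin d)
    (R T : ℕ) :
    EntryMeasurable (CompactGroup.unitarize ρ hρ)
      fun U : GaugeConfig d L G => rectangleHolonomy U x i j R T := by
  have hσ := CompactGroup.continuous_unitarize ρ hρ
  unfold rectangleHolonomy
  exact (((entryMeasurable_lineHolonomy hσ _ _ _).mul (entryMeasurable_lineHolonomy hσ _ _ _)).mul
    (EntryMeasurable.inv_unitarize ρ hρ (entryMeasurable_lineHolonomy hσ _ _ _))).mul
    (EntryMeasurable.inv_unitarize ρ hρ (entryMeasurable_lineHolonomy hσ _ _ _))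

/-- The covariant link word is entry-measurable. [folklore] -/
theorem entryMeasurable_linkWord (hρ : Continuous ρ) (j : Fin d) (R a : ℕ) :
    EntryMeasurable (CompactGroup.unitarize ρ hρ)
      fun U : GaugeConfig d L G => linkWord j R a U := by
  have hσ := CompactGroup.continuous_unitarize ρ hρ
  unfold linkWord linkStaple
  exact ((entryMeasurable_apply hσ _).mul
    (((entryMeasurable_lineHolonomy hσ _ _ _).mul (entryMeasurable_lineHolonomy hσ _ _ _)).mul
      (EntryMeasurable.inv_unitarize ρ hρ (entryMeasurable_lineHolonomy hσ _ _ _)))).mul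
    (entryMeasurable_apply_inv hσ _)

/-- The site staple is entry-measurable. [folklore] -/
theorem entryMeasurable_siteStaple (hρ : Continuous ρ) (j : Fin d) (R a : ℕ) :
    EntryMeasurable (CompactGroup.unitarize ρ hρ)
      fun U : GaugeConfig d L G => siteStaple j R a U := by
  have hσ := CompactGroup.continuous_unitarize ρ hρ
  unfold siteStaple
  exact ((entryMeasurable_lineHolonomy hσ _ _ _).mul (entryMeasurable_lineHolonomy hσ _ _ _)).mul
    (EntryMeasurable.inv_unitarize ρ hρ (entryMeasurable_lineHolonomy hσ _ _ _))

omit [NeZero d] [TopologicalSpace G] [IsTopologicalGroup G] [CompactSpace G] [BorelSpace G] in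
/-- The trace of an entry-measurable word is measurable. [folklore] -/
theorem _root_.Literature.MathematicalPhysics.QuantumFieldTheory.WilsonRP.EntryMeasurable.measurable_trace
    {τ : G →* Matrix (Fin N) (Fin N) ℂ}
    {f : GaugeConfig d L G → G} (hf : EntryMeasurable τ f) :
    Measurable fun U => (τ (f U)).trace := by
  simp only [Matrix.trace, Matrix.diag_apply]
  exact Finset.measurable_sum _ fun k _ => hf k k

end Measurability

/-! ## Gram positivity on the torus -/

section Gram

variable {d L N : ℕ} [NeZero d] [NeZero L] [Fact (1 < L)]
variable {G : Type*} [Group G] [TopologicalSpace G] [IsTopologicalGroup G] [CompactSpace G]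
  [MeasurableSpace G] [BorelSpace G]
variable (ρ : G →* Matrix (Fin N) (Fin N) ℂ)

omit [NeZero d] [NeZero L] [Fact (1 < L)] in
/-- Rearranging a Gram double sum of matrix entries. [folklore] -/
private theorem sum_sum_mul_sum_sum {α : Type*} [Fintype α] (S : Finset ℕ) (f g : ℕ → α → α → ℂ) :
    ∑ i : α, ∑ l : α, (∑ a ∈ S, f a i l) * (∑ b ∈ S, g b i l) =
      ∑ a ∈ S, ∑ b ∈ S, ∑ i : α, ∑ l : α, f a i l * g b i l := by
  simp only [Finset.sum_mul_sum]
  calc ∑ i : α, ∑ l : α, ∑ a ∈ S, ∑ b ∈ S, f a i l * g b i l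
      = ∑ i : α, ∑ a ∈ S, ∑ l : α, ∑ b ∈ S, f a i l * g b i l :=
        Finset.sum_congr rfl fun i _ => Finset.sum_comm
    _ = ∑ a ∈ S, ∑ i : α, ∑ l : α, ∑ b ∈ S, f a i l * g b i l := Finset.sum_comm
    _ = ∑ a ∈ S, ∑ i : α, ∑ b ∈ S, ∑ l : α, f a i l * g b i l :=
        Finset.sum_congr rfl fun a _ => Finset.sum_congr rfl fun i _ => Finset.sum_comm
    _ = ∑ a ∈ S, ∑ b ∈ S, ∑ i : α, ∑ l : α, f a i l * g b i l :=
        Finset.sum_congr rfl fun a _ => Finset.sum_comm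

/-- **Gram positivity for link-bisected rectangles** (complex form): for `L` even, `β ≥ 0`,
heights `a + 1 ≤ L/2` and real coefficients,
`0 ≤ ⟨∑_{a,b} c_a c_b tr σ(W_{(a+b+1) × R} based at (-b, 0⃗))⟩_{Λ,β}`. [folklore] -/
theorem wilsonExpectation_gram_link_nonneg (hL : Even L) (hρ : Continuous ρ) {β : ℝ} (hβ : 0 ≤ β)
    {j : Fin d} (hj : j ≠ 0) (R : ℕ) (S : Finset ℕ) (hS : ∀ a ∈ S, a + 1 ≤ L / 2) (c : ℕ → ℝ) :
    0 ≤ wilsonExpectation ρ β fun U : GaugeConfig d L G => ∑ a ∈ S, ∑ b ∈ S, (c a * c b : ℂ) *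
      (CompactGroup.unitarize ρ hρ (rectangleHolonomy U (tBase b) 0 j (a + b + 1) R)).trace := by
  set σ := CompactGroup.unitarize ρ hρ with hσdef
  refine wilsonExpectation_nonneg_of_covariant ρ hL hρ hβ (K := Fin N × Fin N)
    (g := fun il V => ∑ a ∈ S, (c a : ℂ) * σ (linkWord j R a V) il.1 il.2)
    (fun il => Finset.measurable_sum _ fun a _ =>
      (entryMeasurable_linkWord ρ hρ j R a il.1 il.2).const_mul _)
    (Kg := ∑ a ∈ S, ‖(c a : ℂ)‖) (fun il V => ?_) (fun il => ?_) ?_ ?_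
  · -- bound
    refine (norm_sum_le _ _).trans (Finset.sum_le_sum fun a _ => ?_)
    rw [norm_mul]
    exact mul_le_of_le_one_right (norm_nonneg _)
      (CompactGroup.norm_unitarize_apply_le_one ρ hρ _ _ _)
  · -- dependence on `P ∪ C`
    intro U V hUV
    refine Finset.sum_congr rfl fun a ha => ?_
    have hP : ∀ e, IsPosEdge e → U e = V e := fun e he => hUV e (by simp [he])
    have hC : ∀ e, IsCrossEdge e → U e = V e := fun e he => hUV e (by simp [he])
    obtain ⟨hc0, hcR⟩ := isLowerCross_foot (L := L) j hj R
    simp only [linkWord, hC _ hc0.isCrossEdge, hC _ hcR.isCrossEdge,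
      linkStaple_congr j R a fun e he => hP e (isPosEdge_of_isLinkStapleEdge hj (hS a ha) he)]
  · -- measurability of `Φ`
    refine Finset.measurable_sum _ fun a _ => Finset.measurable_sum _ fun b _ => ?_
    exact (entryMeasurable_rectangleHolonomy ρ hρ _ _ _ _ _).measurable_trace.const_mul _
  · -- covariance
    intro U Y
    have hL' : (∑ a ∈ S, ∑ b ∈ S, (c a * c b : ℂ) *
        (σ (rectangleHolonomy (translate Y U) (tBase b) 0 j (a + b + 1) R)).trace) =
        ∑ a ∈ S, ∑ b ∈ S, ∑ i, ∑ l, (c a * c b : ℂ) *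
          (σ (linkWord j R a (LatticeRP.splice crossEdges (U, Y))) i l *
            conj (σ (linkWord j R b U.timeReflect) i l)) := by
      refine Finset.sum_congr rfl fun a ha => Finset.sum_congr rfl fun b hb => ?_
      rw [trace_rectangleHolonomy_translate ρ hL hρ hj (hS a ha) (hS b hb) U Y, Finset.mul_sum]
      refine Finset.sum_congr rfl fun i _ => ?_
      rw [Finset.mul_sum]
    rw [hL', Fintype.sum_prod_type]
    simp only [map_sum, map_mul, Complex.conj_ofReal]
    rw [sum_sum_mul_sum_sum]
    refine Finset.sum_congr rfl fun a _ => Finset.sum_congr rfl fun b _ =>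
      Finset.sum_congr rfl fun i _ => Finset.sum_congr rfl fun l _ => by ring

/-- **Gram positivity for site-bisected rectangles** (complex form): for `L` even, any real `β`,
heights `a ≤ L/2` and real coefficients,
`0 ≤ ⟨∑_{a,b} c_a c_b tr σ(W_{(a+b) × R} based at (-b, 0⃗))⟩_{Λ,β}`. [folklore] -/
theorem wilsonExpectation_gram_site_nonneg (hL : Even L) (hρ : Continuous ρ) (β : ℝ)
    {j : Fin d} (hj : j ≠ 0) (R : ℕ) (S : Finset ℕ) (hS : ∀ a ∈ S, a ≤ L / 2) (c : ℕ → ℝ) :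
    0 ≤ wilsonExpectation ρ β fun U : GaugeConfig d L G => ∑ a ∈ S, ∑ b ∈ S, (c a * c b : ℂ) *
      (CompactGroup.unitarize ρ hρ (rectangleHolonomy U (tBase b) 0 j (a + b) R)).trace := by
  set σ := CompactGroup.unitarize ρ hρ with hσdef
  haveI := isProbabilityMeasure_wilsonMeasure (d := d) (L := L) ρ hρ β
  -- the family `F_{il} = ∑_a c_a σ(staple'_a)_{il}`
  set F : Fin N × Fin N → GaugeConfig d L G → ℂ :=
    fun il V => ∑ a ∈ S, (c a : ℂ) * σ (siteStaple j R a V) il.1 il.2 with hFdef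
  have hFm : ∀ il, Measurable (F il) := fun il =>
    Finset.measurable_sum _ fun a _ => (entryMeasurable_siteStaple ρ hρ j R a il.1 il.2).const_mul _
  have hFb : ∀ il V, ‖F il V‖ ≤ ∑ a ∈ S, ‖(c a : ℂ)‖ := fun il V => by
    refine (norm_sum_le _ _).trans (Finset.sum_le_sum fun a _ => ?_)
    rw [norm_mul]
    exact mul_le_of_le_one_right (norm_nonneg _)
      (CompactGroup.norm_unitarize_apply_le_one ρ hρ _ _ _)
  have hFdep : ∀ il, DependsOn (F il)
      ((sitePosEdges ∪ sharedEdges : Finset (Edge d L)) : Set (Edge d L)) := by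
    intro il U V hUV
    refine Finset.sum_congr rfl fun a ha => ?_
    have h : ∀ e, IsSitePosEdge e ∨ IsSharedEdge e → U e = V e := fun e he => hUV e (by
      rcases he with he | he <;> simp [he])
    simp only [siteStaple_congr j R a fun e he =>
      h e (isSitePosEdge_or_isSharedEdge_of_isSiteStapleEdge hj (hS a ha) he)]
  -- positivity of each `⟨conj F_{il}(Θ'U) F_{il}(U)⟩`
  have hpos : ∀ il, 0 ≤ wilsonExpectation ρ β fun U => conj (F il U.negReflect) * F il U := fun il =>
    wilsonExpectation_siteReflectionPositive ρ hL hρ β (F il) (hFm il) ⟨_, hFb il⟩ (hFdep il)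
  -- the pointwise identity `∑_{il} conj F_{il}(Θ'U) F_{il}(U) = Φ(U)`
  have hpt : ∀ U : GaugeConfig d L G, (∑ il : Fin N × Fin N, conj (F il U.negReflect) * F il U) =
      ∑ a ∈ S, ∑ b ∈ S, (c a * c b : ℂ) * (σ (rectangleHolonomy U (tBase b) 0 j (a + b) R)).trace := by
    intro U
    have hR : ∀ a b, (σ (rectangleHolonomy U (tBase b) 0 j (a + b) R)).trace =
        ∑ i, ∑ l, σ (siteStaple j R a U) i l * conj (σ (siteStaple j R b U.negReflect) i l) := by
      intro a b
      rw [rectangleHolonomy_eq_site U hj, CompactGroup.trace_conj_eq, trace_unitarize_mul_inv ρ hρ]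
    simp_rw [hR]
    rw [Fintype.sum_prod_type]
    simp only [hFdef, map_sum, map_mul, Complex.conj_ofReal]
    have h2 : ∀ a b, (c a * c b : ℂ) * ∑ i, ∑ l, σ (siteStaple j R a U) i l *
        conj (σ (siteStaple j R b U.negReflect) i l) =
        ∑ i, ∑ l, (c a * c b : ℂ) * (σ (siteStaple j R a U) i l *
          conj (σ (siteStaple j R b U.negReflect) i l)) := by
      intro a b
      rw [Finset.mul_sum]
      refine Finset.sum_congr rfl fun i _ => ?_
      rw [Finset.mul_sum]
    simp_rw [h2]
    rw [show (∑ i : Fin N, ∑ l : Fin N, (∑ b ∈ S, (c b : ℂ) * conj (σ (siteStaple j R b U.negReflect) i l)) *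
        ∑ a ∈ S, (c a : ℂ) * σ (siteStaple j R a U) i l) =
        ∑ i : Fin N, ∑ l : Fin N, (∑ a ∈ S, (c a : ℂ) * σ (siteStaple j R a U) i l) *
          ∑ b ∈ S, (c b : ℂ) * conj (σ (siteStaple j R b U.negReflect) i l) from
      Finset.sum_congr rfl fun i _ => Finset.sum_congr rfl fun l _ => mul_comm _ _,
      sum_sum_mul_sum_sum]
    refine Finset.sum_congr rfl fun a _ => Finset.sum_congr rfl fun b _ =>
      Finset.sum_congr rfl fun i _ => Finset.sum_congr rfl fun l _ => by ring
  -- linearity of the expectation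
  have hint : ∀ il, Integrable (fun U : GaugeConfig d L G => conj (F il U.negReflect) * F il U)
      (wilsonMeasure ρ β) := fun il =>
    Integrable.of_bound
      ((Complex.continuous_conj.measurable.comp ((hFm il).comp measurable_negReflect)).mul
        (hFm il)).aestronglyMeasurable ((∑ a ∈ S, ‖(c a : ℂ)‖) * ∑ a ∈ S, ‖(c a : ℂ)‖)
      (ae_of_all _ fun U => by
        rw [norm_mul, Complex.norm_conj]
        exact mul_le_mul (hFb _ _) (hFb _ _) (norm_nonneg _)
          ((norm_nonneg _).trans (hFb il U)))
  have hsum : wilsonExpectation ρ β (fun U : GaugeConfig d L G => ∑ a ∈ S, ∑ b ∈ S,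
      (c a * c b : ℂ) * (σ (rectangleHolonomy U (tBase b) 0 j (a + b) R)).trace) =
      ∑ il : Fin N × Fin N, wilsonExpectation ρ β fun U => conj (F il U.negReflect) * F il U := by
    unfold wilsonExpectation
    rw [← integral_finsetSum _ fun il _ => hint il]
    exact integral_congr_ae (ae_of_all _ fun U => (hpt U).symm)
  rw [hsum]
  exact Finset.sum_nonneg fun il _ => hpos il

/-! ### From complex Gram positivity to the real Wilson loop expectations -/

omit [NeZero d] [Fact (1 < L)] in
/-- Wilson loop expectations do not depend on the base point (translation invariance of the
torus Wilson state). [folklore] -/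
theorem wilsonExpectation_wilsonLoop_base (β : ℝ) (x : Site d L) (i j : Fin d) (R T : ℕ) :
    wilsonExpectation ρ β (wilsonLoop ρ x i j R T) =
      wilsonExpectation ρ β (wilsonLoop ρ (0 : Site d L) i j R T) := by
  rw [← wilsonExpectation_comp_torusConfigShift ρ β (-x) (wilsonLoop ρ (0 : Site d L) i j R T)]
  congr 1
  funext U
  simp only [Function.comp_apply, wilsonLoop, rectangleHolonomy_torusConfigShift, zero_sub, neg_neg]

omit [NeZero d] [NeZero L] [Fact (1 < L)] [TopologicalSpace G] [IsTopologicalGroup G] [CompactSpace G]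
  [MeasurableSpace G] [BorelSpace G] in
/-- `Re tr ρ(U_γ) = N · W_γ(U)`. [folklore] -/
theorem re_trace_eq_mul_wilsonLoop (hN : N ≠ 0) (x : Site d L) (i j : Fin d) (R T : ℕ)
    (U : GaugeConfig d L G) :
    ((ρ (rectangleHolonomy U x i j R T)).trace).re = N * wilsonLoop ρ x i j R T U := by
  rw [wilsonLoop, mul_inv_cancel_left₀ (Nat.cast_ne_zero.2 hN)]

omit [Fact (1 < L)] in
/-- The real part of a Gram expectation of unitarised loop traces is the Gram sum of the real
Wilson loop expectations (linearity, `Re tr σ = Re tr ρ`, translation to the base point `0`).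
[folklore] -/
theorem re_wilsonExpectation_gram (hρ : Continuous ρ) (hN : N ≠ 0) (β : ℝ) (j : Fin d) (R : ℕ)
    (h : ℕ → ℕ → ℕ) (S : Finset ℕ) (c : ℕ → ℝ) :
    (wilsonExpectation ρ β fun U : GaugeConfig d L G => ∑ a ∈ S, ∑ b ∈ S, (c a * c b : ℂ) *
      (CompactGroup.unitarize ρ hρ (rectangleHolonomy U (tBase b) 0 j (h a b) R)).trace).re =
      N * ∑ a ∈ S, ∑ b ∈ S, c a * c b *
        wilsonExpectation ρ β (wilsonLoop ρ (0 : Site d L) 0 j (h a b) R) := by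
  set σ := CompactGroup.unitarize ρ hρ with hσdef
  haveI := isProbabilityMeasure_wilsonMeasure (d := d) (L := L) ρ hρ β
  have htm : ∀ a b, Measurable fun U : GaugeConfig d L G =>
      (σ (rectangleHolonomy U (tBase b) 0 j (h a b) R)).trace := fun a b =>
    (entryMeasurable_rectangleHolonomy ρ hρ _ _ _ _ _).measurable_trace
  have htb : ∀ a b (U : GaugeConfig d L G),
      ‖(σ (rectangleHolonomy U (tBase b) 0 j (h a b) R)).trace‖ ≤ N := fun a b U => by
    rw [Matrix.trace]
    refine (norm_sum_le _ _).trans ?_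
    calc ∑ k, ‖Matrix.diag (σ (rectangleHolonomy U (tBase b) 0 j (h a b) R)) k‖
        ≤ ∑ _k : Fin N, (1 : ℝ) := Finset.sum_le_sum fun k _ =>
          CompactGroup.norm_unitarize_apply_le_one ρ hρ _ k k
      _ = N := by simp
  have hint : ∀ a b, Integrable (fun U : GaugeConfig d L G =>
      (c a * c b : ℂ) * (σ (rectangleHolonomy U (tBase b) 0 j (h a b) R)).trace)
      (wilsonMeasure ρ β) := fun a b =>
    (Integrable.of_bound (μ := wilsonMeasure ρ β) (htm a b).aestronglyMeasurable _
      (ae_of_all _ (htb a b))).const_mul _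
  unfold wilsonExpectation
  rw [integral_finsetSum _ fun a _ => integrable_finsetSum _ fun b _ => hint a b, Complex.re_sum,
    Finset.mul_sum]
  refine Finset.sum_congr rfl fun a _ => ?_
  rw [integral_finsetSum _ fun b _ => hint a b, Complex.re_sum, Finset.mul_sum]
  refine Finset.sum_congr rfl fun b _ => ?_
  have hre : (∫ U : GaugeConfig d L G,
      (σ (rectangleHolonomy U (tBase b) 0 j (h a b) R)).trace ∂wilsonMeasure ρ β).re =
      ∫ U : GaugeConfig d L G,
        ((σ (rectangleHolonomy U (tBase b) 0 j (h a b) R)).trace).re ∂wilsonMeasure ρ β := by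
    have := integral_re (Integrable.of_bound (μ := wilsonMeasure ρ β) (htm a b).aestronglyMeasurable _
      (ae_of_all _ (htb a b)))
    simpa only [RCLike.re_to_complex] using this.symm
  have hI : ∫ U : GaugeConfig d L G,
      ((σ (rectangleHolonomy U (tBase b) 0 j (h a b) R)).trace).re ∂wilsonMeasure ρ β =
      N * ∫ U : GaugeConfig d L G, wilsonLoop ρ (tBase b) 0 j (h a b) R U ∂wilsonMeasure ρ β := by
    rw [← integral_const_mul]
    refine integral_congr_ae (ae_of_all _ fun U => ?_)
    simp only [hσdef, CompactGroup.trace_unitarize, re_trace_eq_mul_wilsonLoop ρ hN]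
  have hW := wilsonExpectation_wilsonLoop_base ρ β (tBase b : Site d L) 0 j (h a b) R
  unfold wilsonExpectation at hW
  rw [integral_const_mul, ← Complex.ofReal_mul, Complex.re_ofReal_mul, hre, hI, ← hW]
  ring

/-- **Gram inequality for Wilson loops of odd height** (torus form): for `L` even, `β ≥ 0`,
continuous `ρ`, a spatial direction `j ≠ 0`, heights `a + 1 ≤ L/2` (`a ∈ S`) and real
coefficients `c`, `0 ≤ ∑_{a,b ∈ S} c_a c_b ⟨W_{(a+b+1) × R}⟩_{Λ_L,β}`: the matrix
`[⟨W_{(s+t+1) × R}⟩]_{s,t}` is positive semi-definite (reflection positivity in the hyperplane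
between time slices, Seiler LNP 159 §2). [folklore] -/
theorem gram_wilsonLoop_nonneg_link (hL : Even L) (hρ : Continuous ρ) {β : ℝ} (hβ : 0 ≤ β)
    {j : Fin d} (hj : j ≠ 0) (R : ℕ) (S : Finset ℕ) (hS : ∀ a ∈ S, a + 1 ≤ L / 2) (c : ℕ → ℝ) :
    0 ≤ ∑ a ∈ S, ∑ b ∈ S, c a * c b *
      wilsonExpectation ρ β (wilsonLoop ρ (0 : Site d L) 0 j (a + b + 1) R) := by
  rcases Nat.eq_zero_or_pos N with hN | hN
  · subst hN
    simp [wilsonLoop, wilsonExpectation]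
  have h := (Complex.nonneg_iff.1 (wilsonExpectation_gram_link_nonneg ρ hL hρ hβ hj R S hS c)).1
  rw [re_wilsonExpectation_gram ρ hρ hN.ne' β j R (fun a b => a + b + 1) S c] at h
  exact nonneg_of_mul_nonneg_right h (Nat.cast_pos.2 hN)

/-- **Gram inequality for Wilson loops of even height** (torus form): for `L` even, any real
`β`, continuous `ρ`, `j ≠ 0`, heights `a ≤ L/2` (`a ∈ S`) and real coefficients `c`,
`0 ≤ ∑_{a,b ∈ S} c_a c_b ⟨W_{(a+b) × R}⟩_{Λ_L,β}`: the matrix `[⟨W_{(s+t) × R}⟩]_{s,t}` is positive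
semi-definite (reflection positivity in the hyperplane through sites). [folklore] -/
theorem gram_wilsonLoop_nonneg_site (hL : Even L) (hρ : Continuous ρ) (β : ℝ)
    {j : Fin d} (hj : j ≠ 0) (R : ℕ) (S : Finset ℕ) (hS : ∀ a ∈ S, a ≤ L / 2) (c : ℕ → ℝ) :
    0 ≤ ∑ a ∈ S, ∑ b ∈ S, c a * c b *
      wilsonExpectation ρ β (wilsonLoop ρ (0 : Site d L) 0 j (a + b) R) := by
  rcases Nat.eq_zero_or_pos N with hN | hN
  · subst hN
    simp [wilsonLoop, wilsonExpectation]
  have h := (Complex.nonneg_iff.1 (wilsonExpectation_gram_site_nonneg ρ hL hρ β hj R S hS c)).1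
  rw [re_wilsonExpectation_gram ρ hρ hN.ne' β j R (fun a b => a + b) S c] at h
  exact nonneg_of_mul_nonneg_right h (Nat.cast_pos.2 hN)

end Gram

end WilsonLoopRP

/-! ## The torus theorems without the `Fact (1 < L)` instance -/

section Main

variable {d L N : ℕ} {G : Type*} [Group G] [TopologicalSpace G] [IsTopologicalGroup G]
  [CompactSpace G] [MeasurableSpace G] [BorelSpace G] (ρ : G →* Matrix (Fin N) (Fin N) ℂ)

/-- **Gram inequality for Wilson loops of odd height on the even torus** (consequence of
Osterwalder–Seiler reflection positivity in the hyperplane between time slices; E. Seiler,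
LNP 159 (1982) §2: `W(R, s+t+1) = ⟨Ψ_s, 𝕋 Ψ_t⟩`-type positivity). For `L` even, `β ≥ 0`,
continuous `ρ`, a spatial direction `j ≠ 0`, a finite set `S` of heights with `a + 1 ≤ L/2` and
real coefficients: `0 ≤ ∑_{a,b ∈ S} c_a c_b ⟨W_{(a+b+1) × R}⟩_{Λ_L,β}` for the rectangular
loops at the origin with `a + b + 1` steps in the time direction `0` and `R` steps in direction
`j` (`wilsonLoop ρ 0 0 j (a+b+1) R`). [folklore] -/
theorem gram_wilsonLoop_nonneg_odd [NeZero d] [NeZero L] (hL : Even L) (hρ : Continuous ρ)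
    {β : ℝ} (hβ : 0 ≤ β) {j : Fin d} (hj : j ≠ 0) (R : ℕ) (S : Finset ℕ)
    (hS : ∀ a ∈ S, a + 1 ≤ L / 2) (c : ℕ → ℝ) :
    0 ≤ ∑ a ∈ S, ∑ b ∈ S, c a * c b *
      wilsonExpectation ρ β (wilsonLoop ρ (0 : Site d L) 0 j (a + b + 1) R) := by
  haveI : Fact (1 < L) := ⟨by
    obtain ⟨r, hr⟩ := hL
    have := NeZero.ne L
    omega⟩
  exact WilsonLoopRP.gram_wilsonLoop_nonneg_link ρ hL hρ hβ hj R S hS c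

/-- **Gram inequality for Wilson loops of even height on the even torus** (consequence of
reflection positivity in the hyperplane through sites; any real `β`). For `L` even, continuous
`ρ`, `j ≠ 0`, heights `a ≤ L/2` and real coefficients:
`0 ≤ ∑_{a,b ∈ S} c_a c_b ⟨W_{(a+b) × R}⟩_{Λ_L,β}`. [folklore] -/
theorem gram_wilsonLoop_nonneg_even [NeZero d] [NeZero L] (hL : Even L) (hρ : Continuous ρ)
    (β : ℝ) {j : Fin d} (hj : j ≠ 0) (R : ℕ) (S : Finset ℕ) (hS : ∀ a ∈ S, a ≤ L / 2)
    (c : ℕ → ℝ) :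
    0 ≤ ∑ a ∈ S, ∑ b ∈ S, c a * c b *
      wilsonExpectation ρ β (wilsonLoop ρ (0 : Site d L) 0 j (a + b) R) := by
  haveI : Fact (1 < L) := ⟨by
    obtain ⟨r, hr⟩ := hL
    have := NeZero.ne L
    omega⟩
  exact WilsonLoopRP.gram_wilsonLoop_nonneg_site ρ hL hρ β hj R S hS c

end Main

end

end Literature.MathematicalPhysics.QuantumFieldTheory
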